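import Summits.CriticalPhenomena.PercolationContinuityZ3.Theorems.Transplant.FKDoubleFanOneSidedConeS
import HarnessLib

/-!
# Double fans `K₂ ∨ P_{m+1}`: the SIGN ORTHANT of the `a`-images (certificates A: the nine coordinate signs)

Helper file (`--supports stmt-CriticalPhenomena-4575`), FK sub-lane `prim-bschramm-fk-3` (gen 39); builds on p205010 (kernel theorem, internal
audit signed; external expert review pending).  No named facts, no sorries; standard axioms.  Memo `bschramm/prim-bschramm-fk-3/FAR-CROSS-XIV.md` §0(F).

For `F, w` with the eight `Valid` inequalities (`0 ≤ q ≤ 1`) the hat–Plücker coordinates of `a = imgA q F w` have FIXED SIGNS: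
`a_ux, a_uy, a_uv, a_xv, a_yv, a_zv ≥ 0` and `a_uz, a_xz, a_yz ≤ 0` (only `a_xy` is indefinite).  Each sign is an explicit identity
`= Σ c_j·(q-factor)·(valid form of F)·(valid form of w)`, `c_j ≥ 0` (LP certificates, kit j275845; e.g. `a_ux = (F₀+F_ab)(F_ac κ_ab(w) + F₀ N^{bc}(w))`,
`a_xv = (…)·N^{ac}(F)`, `−a_uz = F_ac (F₀+F_ab) w_y w_bc`).  Used by `…ConeSSigns` (the functional `e₀` of the exact criterion `…ConeSCross`).
[folklore]
-/

noncomputable section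

namespace Summit.CriticalPhenomena.PercolationContinuityZ3.Theorems

namespace FK

namespace ThreeApex

section Identities

variable (q : ℝ) (F w : V5)

/-- `a_ux ≥ 0` for the `a`-image `imgA q F w`: the certificate identity (non-negative combination of valid forms). [folklore] -/
theorem imgA_ux_nonneg_eq :
    (imgA q F w).ux =
      (F.z0 * F.z0) * masterN q (swapAB w)
      + (F.z0 * F.zab) * masterN q (swapAB w)
      + (F.z0 * F.zac) * kap (swapAB w)
      + (F.zab * F.zac) * kap (swapAB w) := by
  simp only [imgA, wedgeH, fanCombo, conv, edgeAC, detach, V5.total, hx, hy, hz, masterN, kap, swapAB]; ring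

/-- `a_uy ≥ 0` for the `a`-image `imgA q F w`: the certificate identity (non-negative combination of valid forms). [folklore] -/
theorem imgA_uy_nonneg_eq :
    (imgA q F w).uy =
      masterN q F * (w.z0 * w.z0)
      + masterN q F * (w.z0 * w.zac)
      + kap F * (w.z0 * w.zbc)
      + kap F * (w.zac * w.zbc) := by
  simp only [imgA, wedgeH, fanCombo, conv, edgeAC, detach, V5.total, hx, hy, hz, masterN, kap]; ring

/-- `a_uz ≤ 0` for the `a`-image `imgA q F w`: the certificate identity (non-negative combination of valid forms). [folklore] -/
theorem imgA_uz_nonpos_eq :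
    -(imgA q F w).uz =
      (F.z0 * F.zac) * (w.z0 * w.zbc)
      + (F.z0 * F.zac) * (w.zac * w.zbc)
      + (F.zab * F.zac) * (w.z0 * w.zbc)
      + (F.zab * F.zac) * (w.zac * w.zbc) := by
  simp only [imgA, wedgeH, fanCombo, conv, edgeAC, detach, V5.total, hx, hy, hz]; ring

/-- `a_uv ≥ 0` for the `a`-image `imgA q F w`: the certificate identity (non-negative combination of valid forms). [folklore] -/
theorem imgA_uv_nonneg_eq :
    (imgA q F w).uv =
      (F.z0 * F.z0) * masterN q (swapAB w)
      + (F.z0 * F.zac) * masterN q (swapAB w)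
      + (F.z0 * F.zbc) * masterN q (swapAB w)
      + (F.zac * F.zbc) * masterN q (swapAB w)
      + masterN q F * (w.z0 * w.z0)
      + masterN q F * (w.z0 * w.zab)
      + masterN q F * (w.z0 * w.zbc)
      + (1 / 2 : ℝ) * q ^ 2 * masterN q F * (w.zab * w.zbc)
      + (1 / 2 : ℝ) * (q * (1 - q)) * masterN q F * (w.zab * w.zbc)
      + (1 / 2 : ℝ) * (2 - q) * masterN q F * (w.zab * w.zbc)
      + masterN q F * kap w
      + (1 - q) * kap F * kap (swapAB w)
      + kap (swapBC F) * masterN q (swapAB w) := by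
  simp only [imgA, wedgeH, fanCombo, conv, edgeAC, detach, V5.total, hx, hy, hz, masterN, kap, swapAB, swapBC]; ring

/-- `a_xz ≤ 0` for the `a`-image `imgA q F w`: the certificate identity (non-negative combination of valid forms). [folklore] -/
theorem imgA_xz_nonpos_eq :
    -(imgA q F w).xz =
      (F.z0 * F.z0) * masterN q (swapAB w)
      + (F.z0 * F.zab) * masterN q (swapAB w)
      + (F.z0 * F.zac) * masterN q (swapAB w)
      + (F.z0 * F.zac) * kap (swapAB w)
      + (1 - q) * (F.z0 * F.zac) * kap (swapAB w)
      + (F.zab * F.zac) * masterN q (swapAB w)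
      + (F.zab * F.zac) * kap (swapAB w)
      + (1 - q) * (F.zab * F.zac) * kap (swapAB w) := by
  simp only [imgA, wedgeH, fanCombo, conv, edgeAC, detach, V5.total, hx, hy, hz, masterN, kap, swapAB]; ring

/-- `a_xv ≥ 0` for the `a`-image `imgA q F w`: the certificate identity (non-negative combination of valid forms). [folklore] -/
theorem imgA_xv_nonneg_eq :
    (imgA q F w).xv =
      masterN q F * (w.z0 * w.z0)
      + masterN q F * (w.z0 * w.zab)
      + masterN q F * (w.z0 * w.zac)
      + (1 / 2 : ℝ) * q * masterN q F * (w.zab * w.zac)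
      + (1 / 2 : ℝ) * (2 - q) * masterN q F * (w.zab * w.zac)
      + masterN q F * masterN q (swapBC w)
      + (1 - q) * masterN q F * kap (swapBC w)
      + masterN q F * kap (swapAB w) := by
  simp only [imgA, wedgeH, fanCombo, conv, edgeAC, detach, V5.total, hx, hy, hz, masterN, kap, swapAB, swapBC]; ring

/-- `a_yz ≤ 0` for the `a`-image `imgA q F w`: the certificate identity (non-negative combination of valid forms). [folklore] -/
theorem imgA_yz_nonpos_eq :
    -(imgA q F w).yz =
      (1 / 2 : ℝ) * q * (F.z0 * F.zac) * (w.zac * w.zbc)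
      + (1 / 2 : ℝ) * (2 - q) * (F.z0 * F.zac) * (w.zac * w.zbc)
      + (F.zab * F.zac) * (w.zac * w.zbc)
      + (F.zac * F.zac) * (w.zac * w.zbc)
      + (F.zac * F.zbc) * (w.zac * w.zbc)
      + (F.zac * F.z1) * (w.zac * w.zbc)
      + masterN q F * (w.z0 * w.z0)
      + (1 / 2 : ℝ) * q * masterN q F * (w.z0 * w.zac)
      + (1 / 2 : ℝ) * (2 - q) * masterN q F * (w.z0 * w.zac)
      + (1 / 2 : ℝ) * q * masterN q F * (w.z0 * w.zbc)
      + (1 / 2 : ℝ) * (2 - q) * masterN q F * (w.z0 * w.zbc)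
      + (2 - q) * kap F * (w.z0 * w.zbc)
      + kap F * (w.zac * w.zbc) := by
  simp only [imgA, wedgeH, fanCombo, conv, edgeAC, detach, V5.total, hx, hy, hz, masterN, kap]; ring

/-- `a_yv ≥ 0` for the `a`-image `imgA q F w`: the certificate identity (non-negative combination of valid forms). [folklore] -/
theorem imgA_yv_nonneg_eq :
    (imgA q F w).yv =
      (F.z0 * F.z0) * masterN q (swapAB w)
      + (F.z0 * F.zab) * masterN q (swapAB w)
      + (F.z0 * F.zac) * masterN q (swapAB w)
      + (F.z0 * F.zbc) * masterN q (swapAB w)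
      + (1 / 2 : ℝ) * q * (F.z0 * F.z1) * masterN q (swapAB w)
      + (1 / 2 : ℝ) * (2 - q) * (F.z0 * F.z1) * masterN q (swapAB w)
      + masterN q (swapAB F) * masterN q (swapAB w)
      + (1 - q) * kap (swapAB F) * masterN q (swapAB w) := by
  simp only [imgA, wedgeH, fanCombo, conv, edgeAC, detach, V5.total, hx, hy, hz, masterN, kap, swapAB]; ring

/-- `a_zv ≥ 0` for the `a`-image `imgA q F w`: the certificate identity (non-negative combination of valid forms). [folklore] -/
theorem imgA_zv_nonneg_eq :
    (imgA q F w).zv =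
      (F.z0 * F.z0) * masterN q (swapAB w)
      + (F.z0 * F.zab) * masterN q (swapAB w)
      + (1 / 2 : ℝ) * (q * (1 - q)) * (F.z0 * F.zac) * (w.z0 * w.zbc)
      + (1 / 4 : ℝ) * q * (F.z0 * F.zac) * (w.zab * w.zbc)
      + (1 / 4 : ℝ) * (2 - q) * (F.z0 * F.zac) * (w.zab * w.zbc)
      + (1 / 2 : ℝ) * (F.z0 * F.zac) * (w.zac * w.zbc)
      + 2 * (F.z0 * F.zac) * masterN q (swapAB w)
      + (q * (1 - q)) * (F.z0 * F.zac) * kap (swapAB w)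
      + (1 - q) ^ 2 * (F.z0 * F.zac) * kap (swapAB w)
      + (F.z0 * F.zbc) * masterN q (swapAB w)
      + (F.z0 * F.z1) * masterN q (swapAB w)
      + (1 / 2 : ℝ) * (q * (1 - q)) * (F.zab * F.zac) * (w.z0 * w.zbc)
      + (1 / 2 : ℝ) * (F.zab * F.zac) * (w.zab * w.zbc)
      + (1 / 2 : ℝ) * (F.zab * F.zac) * (w.zac * w.zbc)
      + (F.zab * F.zac) * masterN q (swapAB w)
      + (q * (1 - q)) * (F.zab * F.zac) * kap (swapAB w)
      + (1 - q) ^ 2 * (F.zab * F.zac) * kap (swapAB w)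
      + (1 / 2 : ℝ) * (F.zac * F.zac) * (w.zab * w.zbc)
      + (1 / 2 : ℝ) * q * (F.zac * F.zac) * (w.zac * w.zbc)
      + (1 / 2 : ℝ) * (q * (1 - q)) * (F.zac * F.zac) * (w.zac * w.zbc)
      + (1 / 2 : ℝ) * (1 - q) ^ 2 * (F.zac * F.zac) * (w.zac * w.zbc)
      + (F.zac * F.zac) * masterN q (swapAB w)
      + (1 - q) * (F.zac * F.zac) * kap (swapAB w)
      + (1 / 2 : ℝ) * (q * (1 - q)) * (F.zac * F.zbc) * (w.z0 * w.zbc)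
      + (1 / 2 : ℝ) * (F.zac * F.zbc) * (w.zab * w.zbc)
      + (1 / 2 : ℝ) * q * (F.zac * F.zbc) * (w.zac * w.zbc)
      + (1 / 4 : ℝ) * (q * (1 - q)) * (F.zac * F.zbc) * (w.zac * w.zbc)
      + (1 / 4 : ℝ) * ((1 - q) * (2 - q)) * (F.zac * F.zbc) * (w.zac * w.zbc)
      + (F.zac * F.zbc) * masterN q (swapAB w)
      + (q * (1 - q)) * (F.zac * F.zbc) * kap (swapAB w)
      + (1 - q) ^ 2 * (F.zac * F.zbc) * kap (swapAB w)
      + (1 / 4 : ℝ) * q ^ 2 * (F.zac * F.z1) * (w.zab * w.zbc)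
      + (1 / 4 : ℝ) * (q * (1 - q)) * (F.zac * F.z1) * (w.zab * w.zbc)
      + (1 / 4 : ℝ) * (2 - q) * (F.zac * F.z1) * (w.zab * w.zbc)
      + (1 / 2 : ℝ) * (F.zac * F.z1) * (w.zac * w.zbc)
      + (F.zac * F.z1) * masterN q (swapAB w)
      + (1 - q) * (F.zac * F.z1) * kap (swapAB w)
      + masterN q F * (w.z0 * w.z0)
      + (1 / 4 : ℝ) * q * masterN q F * (w.z0 * w.zab)
      + (1 / 4 : ℝ) * (2 - q) * masterN q F * (w.z0 * w.zab)
      + (1 / 4 : ℝ) * q * masterN q F * (w.z0 * w.zac)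
      + (1 / 4 : ℝ) * (2 - q) * masterN q F * (w.z0 * w.zac)
      + masterN q F * (w.z0 * w.zbc)
      + (1 / 2 : ℝ) * masterN q F * kap w
      + (1 / 2 : ℝ) * masterN q F * kap (swapBC w)
      + (1 / 2 : ℝ) * (q * (1 - q)) * lam F * (w.z0 * w.zbc)
      + (1 / 2 : ℝ) * (1 - q) ^ 2 * kap F * (w.z0 * w.zbc)
      + (1 / 2 : ℝ) * (1 - q) * kap F * lam w
      + (1 / 2 : ℝ) * (1 - q) * kap F * kap (swapAB w) := by
  simp only [imgA, wedgeH, fanCombo, conv, edgeAC, detach, V5.total, hx, hy, hz, masterN, kap, lam, swapAB, swapBC]; ring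

end Identities

section Signs

variable {q : ℝ} {F w : V5} (hq0 : 0 ≤ q) (hq1 : q ≤ 1) (hF : Valid q F) (hw : Valid q w)
include hq0 hq1 hF hw

omit hq0 in
/-- `a_ux ≥ 0` for every `a`-image over `Valid × Valid` (`0 ≤ q ≤ 1`). [folklore] -/
theorem imgA_ux_nonneg : 0 ≤ (imgA q F w).ux := by
  obtain ⟨⟨hF0, hFab, hFac, hFbc, hF1⟩, hFN, hFNab, hFNbc, hFL, hFk, hFkb, hFkc⟩ := hF
  obtain ⟨⟨hw0, hwab, hwac, hwbc, hw1⟩, hwN, hwNab, hwNbc, hwL, hwk, hwkb, hwkc⟩ := hw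
  have hp : 0 ≤ 1 - q := by linarith
  have hr : 0 ≤ 2 - q := by linarith
  rw [imgA_ux_nonneg_eq]
  positivity

omit hq0 in
/-- `a_uy ≥ 0` for every `a`-image over `Valid × Valid` (`0 ≤ q ≤ 1`). [folklore] -/
theorem imgA_uy_nonneg : 0 ≤ (imgA q F w).uy := by
  obtain ⟨⟨hF0, hFab, hFac, hFbc, hF1⟩, hFN, hFNab, hFNbc, hFL, hFk, hFkb, hFkc⟩ := hF
  obtain ⟨⟨hw0, hwab, hwac, hwbc, hw1⟩, hwN, hwNab, hwNbc, hwL, hwk, hwkb, hwkc⟩ := hw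
  have hp : 0 ≤ 1 - q := by linarith
  have hr : 0 ≤ 2 - q := by linarith
  rw [imgA_uy_nonneg_eq]
  positivity

omit hq0 in
/-- `a_uz ≤ 0` for every `a`-image over `Valid × Valid` (`0 ≤ q ≤ 1`). [folklore] -/
theorem imgA_uz_nonpos : 0 ≤ -(imgA q F w).uz := by
  obtain ⟨⟨hF0, hFab, hFac, hFbc, hF1⟩, hFN, hFNab, hFNbc, hFL, hFk, hFkb, hFkc⟩ := hF
  obtain ⟨⟨hw0, hwab, hwac, hwbc, hw1⟩, hwN, hwNab, hwNbc, hwL, hwk, hwkb, hwkc⟩ := hw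
  have hp : 0 ≤ 1 - q := by linarith
  have hr : 0 ≤ 2 - q := by linarith
  rw [imgA_uz_nonpos_eq]
  positivity

/-- `a_uv ≥ 0` for every `a`-image over `Valid × Valid` (`0 ≤ q ≤ 1`). [folklore] -/
theorem imgA_uv_nonneg : 0 ≤ (imgA q F w).uv := by
  obtain ⟨⟨hF0, hFab, hFac, hFbc, hF1⟩, hFN, hFNab, hFNbc, hFL, hFk, hFkb, hFkc⟩ := hF
  obtain ⟨⟨hw0, hwab, hwac, hwbc, hw1⟩, hwN, hwNab, hwNbc, hwL, hwk, hwkb, hwkc⟩ := hw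
  have hp : 0 ≤ 1 - q := by linarith
  have hr : 0 ≤ 2 - q := by linarith
  rw [imgA_uv_nonneg_eq]
  positivity

omit hq0 in
/-- `a_xz ≤ 0` for every `a`-image over `Valid × Valid` (`0 ≤ q ≤ 1`). [folklore] -/
theorem imgA_xz_nonpos : 0 ≤ -(imgA q F w).xz := by
  obtain ⟨⟨hF0, hFab, hFac, hFbc, hF1⟩, hFN, hFNab, hFNbc, hFL, hFk, hFkb, hFkc⟩ := hF
  obtain ⟨⟨hw0, hwab, hwac, hwbc, hw1⟩, hwN, hwNab, hwNbc, hwL, hwk, hwkb, hwkc⟩ := hw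
  have hp : 0 ≤ 1 - q := by linarith
  have hr : 0 ≤ 2 - q := by linarith
  rw [imgA_xz_nonpos_eq]
  positivity

/-- `a_xv ≥ 0` for every `a`-image over `Valid × Valid` (`0 ≤ q ≤ 1`). [folklore] -/
theorem imgA_xv_nonneg : 0 ≤ (imgA q F w).xv := by
  obtain ⟨⟨hF0, hFab, hFac, hFbc, hF1⟩, hFN, hFNab, hFNbc, hFL, hFk, hFkb, hFkc⟩ := hF
  obtain ⟨⟨hw0, hwab, hwac, hwbc, hw1⟩, hwN, hwNab, hwNbc, hwL, hwk, hwkb, hwkc⟩ := hw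
  have hp : 0 ≤ 1 - q := by linarith
  have hr : 0 ≤ 2 - q := by linarith
  rw [imgA_xv_nonneg_eq]
  positivity

/-- `a_yz ≤ 0` for every `a`-image over `Valid × Valid` (`0 ≤ q ≤ 1`). [folklore] -/
theorem imgA_yz_nonpos : 0 ≤ -(imgA q F w).yz := by
  obtain ⟨⟨hF0, hFab, hFac, hFbc, hF1⟩, hFN, hFNab, hFNbc, hFL, hFk, hFkb, hFkc⟩ := hF
  obtain ⟨⟨hw0, hwab, hwac, hwbc, hw1⟩, hwN, hwNab, hwNbc, hwL, hwk, hwkb, hwkc⟩ := hw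
  have hp : 0 ≤ 1 - q := by linarith
  have hr : 0 ≤ 2 - q := by linarith
  rw [imgA_yz_nonpos_eq]
  positivity

/-- `a_yv ≥ 0` for every `a`-image over `Valid × Valid` (`0 ≤ q ≤ 1`). [folklore] -/
theorem imgA_yv_nonneg : 0 ≤ (imgA q F w).yv := by
  obtain ⟨⟨hF0, hFab, hFac, hFbc, hF1⟩, hFN, hFNab, hFNbc, hFL, hFk, hFkb, hFkc⟩ := hF
  obtain ⟨⟨hw0, hwab, hwac, hwbc, hw1⟩, hwN, hwNab, hwNbc, hwL, hwk, hwkb, hwkc⟩ := hw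
  have hp : 0 ≤ 1 - q := by linarith
  have hr : 0 ≤ 2 - q := by linarith
  rw [imgA_yv_nonneg_eq]
  positivity

/-- `a_zv ≥ 0` for every `a`-image over `Valid × Valid` (`0 ≤ q ≤ 1`). [folklore] -/
theorem imgA_zv_nonneg : 0 ≤ (imgA q F w).zv := by
  obtain ⟨⟨hF0, hFab, hFac, hFbc, hF1⟩, hFN, hFNab, hFNbc, hFL, hFk, hFkb, hFkc⟩ := hF
  obtain ⟨⟨hw0, hwab, hwac, hwbc, hw1⟩, hwN, hwNab, hwNbc, hwL, hwk, hwkb, hwkc⟩ := hw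
  have hp : 0 ≤ 1 - q := by linarith
  have hr : 0 ≤ 2 - q := by linarith
  rw [imgA_zv_nonneg_eq]
  positivity

end Signs


end ThreeApex

end FK

end Summit.CriticalPhenomena.PercolationContinuityZ3.Theorems
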